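import Summits.BirchSwinnertonDyer.Rank1Residual.Additive.CyclotomicThreeMultiplicativeReduction
import Summits.BirchSwinnertonDyer.Rank1Residual.Additive.CyclotomicZpExtensionQuadratic
import HarnessLib

/-!
# X3/X4 (M)-rows at `p = 3` over `K = ℚ(ζ₃)`: `ord₃ #Ш(V) + ord₃ #Ш(W) ≤ ord₃ #Ш_an(V) + ord₃ #Ш_an(W)`
# for the additive twist `W ≅ V^{(−3)}` of a curve `V` with MULTIPLICATIVE reduction at `3` (line V15, core)

HONEST FRAMING (cell `b2b-bsdres`, run/shared/lean/b2b/bsd-rank1-residual/, verbatim in every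
file): the goal of the cell is to DELETE the COMBINATION-SHAPED residual classes of the
Birch–Swinnerton-Dyer formula for ALL analytic-rank `≤ 1` elliptic curves over `ℚ` — "full BSD
formula for every rank `≤ 1` curve in class `C`" assembled STRICTLY from published theorems — so
that the rank-`≤ 1` remainder becomes exactly the CONSTRUCTION-SHAPED classes, which are TYPED
(missing-input `Prop`s), NOT attempted. This is not "finishing BSD". Seat additive-p4 (research route
on X3/X4), gen 6; the labels of X3/X4 are UNCHANGED by this file; nothing is booked here.

Theorems only (no `def`, no `sorry`, no new named fact). This is the MULTIPLICATIVE twin of the core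
theorem of line V14 (`X3RankZeroCyclotomicThree`: `V` good ordinary at `3`). The (M)-cell of the
classes X3/X4 at `p = 3` consists of the additive curves `W` whose twist `V = W^{(−3)}` has
multiplicative reduction at `3` (X3: `V[3]` reducible; X4: irreducible); for `V` NON-SPLIT at `3`
there is no exceptional zero, and the V14 argument runs verbatim over the quadratic field
`K = ℚ(ζ₃) = ℚ(√−3)`, whose cyclotomic `ℤ₃`-extension is `ℚ(ζ_{3^∞})`:

* a divisibility `char_Λ X(V_K/K_∞) ∋ u·ϖϖ'·L⁺(T)·L⁻(T)` (inline hypothesis `hDivK`, the shape of the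
  reading-facts `Wuthrich2014.thm16_charIdeal_dvd_nonsplitMultiplicative_cyclotomicThree` (X3) /
  `Wuthrich2014.kato_charIdeal_dvd_nonsplitMultiplicative_cyclotomicThree_of_surjective` (X4), with
  the two tame branches `L^±` of `L₃(V)` kept ABSTRACT here: all that is used are their constant
  terms `L⁺(0) = e⁺·[0]⁺_f`, `L⁻(0) = e⁻·∑_{a mod 3}(a/3)[a/3]⁻_f` with `3`-adic UNITS `e^±`
  (hypotheses `hLp0`, `hLm0`; for the non-split prime `e⁺ = 1 − α⁻¹ = 2`, `e⁻ = α⁻¹ = −1`,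
  `α = a₃ = −1` — MTT §I.10/§I.14 with `ε(p) = 0`, tree `IsMultPAdicLFunctionOf.constantCoeff_of_neg_one`
  and `PAdicLFunctionMinusMult`);
* Greenberg's Euler characteristic over `K` at the unique, NON-SPLIT MULTIPLICATIVE prime `𝔭 = (√−3)`
  (inline `hGrK`, the `K`-shape of `Greenberg1999.thm41Analogue_charValue_rankZero_numberField`:
  `f(0)·#V(K)[3^∞]² ∼ 3^{ord₃ ∏ c_w(V_K)}·#Sel_{3^∞}(V_K)`, NO anomalous factor — `l_𝔭 = 1` for odd
  `p`, LNM 1716 p. 112);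
* Birch/Pal for both parities (PROVED in the tree: `ϖ[0]⁺_f = L(V,1)/Ω_V`,
  `ϖ'S⁻ = ±L(W,1)|u_C|c_∞/Ω_W`), Milne 1972 in Dokchitser–Dokchitser's model-free form on `V ⊗ K`
  (`hMilne`) read as an identity of rationals (`card_identity_baseChange`) with
  `ord₃ C(V ⊗ K) = ord₃ ∏ c_w(V_K)` now from MINIMALITY of `V ⊗ K` above `3`
  (`padicValRat_modifiedTamagawaProduct_baseChange_of_mult`), Gross–Zagier–Kolyvagin (`hGZK`) and
  modularity (`hmod`); the cyclotomic setting over `K` is the tree theorem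
  `exists_isCyclotomic_isTopGenerator_cyclotomicThree` (no `hexK`).

Sum: **`ord₃#Ш(V) + ord₃#Ш(W) ≤ ord₃#Ш_an(V) + ord₃#Ш_an(W)`** for `W ≅ V^{(−3)}` additive at `3`,
`V` multiplicative at `3`, both of analytic rank `0`. NOT assumed: any typed input of the cell, any
Selmer descent, any Tamagawa/image bit of `W`. The facts-only corollaries (X3 via Thm. 16, X4 via
Kato's theorem as attributed by Wuthrich, unit rows ⇒ BSD₃(W) ∧ BSD₃(V)) are in the sibling
`XMultRankZeroCyclotomicThreeFacts.lean`. Census (engine A, `N < 2·10⁴`): 228 CORE-open rank-(0,0)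
(M)-rows with `V` non-split at `3` (X3 20, X4 208); the split rows (350) are out of reach of the
evaluation at `T = 0` (exceptional zero).
-/

noncomputable section

open scoped Classical MatrixGroups ModularForm

open CongruenceSubgroup WeierstrassCurve NumberField IsDedekindDomain
  Literature.NumberTheory.EllipticCurves Literature.NumberTheory.EllipticCurves.ModularForms
  Literature.NumberTheory.EllipticCurves.Rank1Residual
  Literature.NumberTheory.EllipticCurves.Rank1Residual.Typed
  Literature.NumberTheory.GaloisRepresentations

namespace Summit.BirchSwinnertonDyer.Rank1Residual.Additive

section Core

variable (K : Type) [Field K] [NumberField K] [IsCyclotomicExtension {3} ℚ K]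
  (V : WeierstrassCurve ℚ) [V.IsElliptic] [V.IsGloballyMinimal]
  (W : WeierstrassCurve ℚ) [W.IsElliptic] [W.IsGloballyMinimal]

/-- **Core theorem (line V15, `p = 3`, multiplicative twist, rank `0 + 0`).** Let `V/ℚ` be globally
minimal with MULTIPLICATIVE reduction at `3` and `W = C • V^{(−3)}` a globally minimal model of its
twist by `−3 = d_K`, `K = ℚ(ζ₃)`, with `W` ADDITIVE at `3` (Kodaira type `I_n*`), both of analytic rank
`0`; `f` the newform of `V`, `ϖ·Ω_V = Ω⁺_f`, `ϖ'·|Ω⁻(V)| = Ω⁻_f`; `L⁺, L⁻ ∈ ℚ₃⟦T⟧` ANY two power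
series with constant terms `L⁺(0) = e⁺·[0]⁺_f`, `L⁻(0) = e⁻·∑_{a mod 3}(a/3)[a/3]⁻_f` for `3`-adic
units `e⁺, e⁻` (for the tame branches of `L₃(V)` at a non-split prime: `e⁺ = 2`, `e⁻ = −1`). ASSUME,
over `K`:
* `hDivK` — a divisibility `X(V/K_∞)` torsion and `u ϖϖ'·L⁺·L⁻ = ι g`, `g ∈ char_Λ X(V/K_∞)`, for
  the cyclotomic `ℤ₃`-extension of `K` with normalised generator (the shape of Wuthrich's Thm. 16 /
  Kato's theorem read over `K`, facts `Wuthrich2014.*nonsplitMultiplicative_cyclotomicThree*`);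
* `hGrK` — Greenberg's Euler characteristic for `V_K` at the non-split multiplicative prime above `3`
  (the `K`-shape of `Greenberg1999.thm41Analogue_charValue_rankZero_numberField`): if
  `Sel_{3^∞}(V_K/K)` is finite and `f_E` generates `char_Λ X(V/K_∞)` then
  `f_E(0)·#V(K)[3^∞]² ∼ 3^{ord₃ ∏_w c_w(V_K)} · #Sel_{3^∞}(V_K/K)` (no anomalous factor).
THEN, with Milne 1972 (`hMilne`), Gross–Zagier–Kolyvagin (`hGZK`) and modularity (`hmod`):
`#Ш_an(V) = q_V`, `#Ш_an(W) = q_W` are rationals with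
**`ord₃ #Ш(V) + ord₃ #Ш(W) ≤ ord₃ q_V + ord₃ q_W`**. Proof: the V14 proof with the anomalous factor
replaced by the units `e^±` and the good-reduction minimality by `padicValRat_modifiedTamagawaProduct_baseChange_of_mult`.
[cite: Wuthrich2014, Thm. 16 and Cor. 19 (pp. 397–399)] [cite: GreenbergLNM1716, §4 pp. 112–113]
[cite: MazurTateTeitelbaum1986Invent, §I.10, §I.14] [cite: Milne1972ArithmeticAV, §1 Thm. 1] -/
theorem XMultCyclotomicThree.exists_padicVal_shaOrder_add_le
    (hGZK : rank_eq_analyticRank_of_analyticRank_le_one) (hmod : hasEntireLFunction_rat)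
    (hMilne : Milne1972.bsdQuotient_baseChange_quadratic_anyModel)
    (C : VariableChange ℚ) (hC : C • V.quadraticTwist (-(3 : ℚ)) = W)
    (hmult : V.HasMultiplicativeReductionAtPrime 3) (hadd : Addv W 3)
    (hrV : V.analyticRank = 0) (hrW : W.analyticRank = 0)
    {N : ℕ} [NeZero N] {f : CuspForm (Gamma0 N) 2} (hf : IsNewformOf V f)
    (ϖ ϖ' : ℚ) (hϖ : (ϖ : ℝ) * V.realPeriodRat = plusPeriod f)
    (hϖ' : (ϖ' : ℝ) * V.imaginaryPeriodRat = minusPeriod f)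
    (Lp Lm : PowerSeries ℚ_[3]) (ep em : ℤ_[3]ˣ)
    (hLp0 : PowerSeries.constantCoeff Lp = ((ep : ℤ_[3]) : ℚ_[3]) * (ratPlusSymbol f 0 : ℚ_[3]))
    (hLm0 : PowerSeries.constantCoeff Lm =
      ((em : ℤ_[3]) : ℚ_[3]) * (legendreMinusSymbolSum f 3 : ℚ_[3]))
    (hDivK : ∀ (κ : ZpExtension K 3) (γ : Field.absoluteGaloisGroup K),
      κ.IsCyclotomic → κ.IsTopGenerator γ →
      (∃ ζ : ℤ_[3]ˣ, IsOfFinOrder ζ ∧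
        ((GaloisRep.cyclotomicCharacter K 3 γ * ζ : ℤ_[3]ˣ) : ℤ_[3]) = (cyclotomicGenerator 3 : ℤ_[3])) →
      ∀ D : (V.baseChange K).SelmerDualData κ γ,
        D.IsTorsion ∧ ∃ g ∈ D.charIdeal, ∃ u : ℤ_[3]ˣ,
          iwasawaToPowerSeries 3 g =
            PowerSeries.C (((u : ℤ_[3]) : ℚ_[3]) * (ϖ : ℚ_[3]) * (ϖ' : ℚ_[3])) * (Lp * Lm))
    (hGrK : ∀ (κ : ZpExtension K 3) (γ : Field.absoluteGaloisGroup K),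
        κ.IsCyclotomic → κ.IsTopGenerator γ →
      ∀ (D : (V.baseChange K).SelmerDualData κ γ) [Module.Finite (IwasawaAlgebra 3) D.X], D.IsTorsion →
      ∀ (fE : IwasawaAlgebra 3), D.charIdeal = Ideal.span {fE} →
        Finite ((V.baseChange K).selmerGroupPInfty 3) →
        ∃ u : ℤ_[3]ˣ,
          ((PowerSeries.constantCoeff fE : ℤ_[3]) : ℚ_[3]) *
              (Nat.card (AddCommGroup.primaryComponent (V.baseChange K).toAffine.Point 3) : ℚ_[3]) ^ 2 =
            ((u : ℤ_[3]) : ℚ_[3]) * (3 : ℚ_[3]) ^ (padicValNat 3 (V.baseChange K).tamagawaProduct) *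
              (Nat.card ((V.baseChange K).selmerGroupPInfty 3) : ℚ_[3])) :
    ∃ qV qW : ℚ, shaAn V = (qV : ℂ) ∧ shaAn W = (qW : ℂ) ∧
      (padicValNat 3 V.shaOrder : ℤ) + padicValNat 3 W.shaOrder ≤ padicValRat 3 qV + padicValRat 3 qW := by
  classical
  set p : ℕ := 3 with hp3
  -- §0 facts about `K`
  have h2 : Module.finrank ℚ K = 2 := finrank_eq_two_of_isCyclotomicExtension_three (K := K)
  have hdK : (NumberField.discr K : ℚ) = -(3 : ℚ) := by
    rw [discr_cyclotomicThree K]; norm_num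
  haveI : IsTotallyComplex K := isTotallyComplex_cyclotomicThree K
  have hC' : C • V.quadraticTwist (NumberField.discr K : ℚ) = W := by rw [hdK]; exact hC
  -- rank 0: `L(·,1) ≠ 0`, Mordell–Weil groups and `Ш` finite
  have hLV : V.entireLFunction 1 ≠ 0 := (V.analyticRank_eq_zero_iff_holds (hmod V)).mp hrV
  have hLW : W.entireLFunction 1 ≠ 0 := (W.analyticRank_eq_zero_iff_holds (hmod W)).mp hrW
  obtain ⟨hmwV, hfinV⟩ := hGZK V (by rw [hrV]; exact zero_le_one)
  obtain ⟨hmwW, hfinW⟩ := hGZK W (by rw [hrW]; exact zero_le_one)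
  haveI : Finite V.sha := hfinV
  haveI : Finite W.sha := hfinW
  haveI hEV : Finite V.toAffine.Point := V.finite_point_of_rank_zero (by rw [hmwV, hrV])
  haveI hEW : Finite W.toAffine.Point := W.finite_point_of_rank_zero (by rw [hmwW, hrW])
  -- the canonical `K`-model `V ⊗ K`: finiteness and Milne's identity
  set VK := V.baseChange K with hVK
  haveI hEK : Finite VK.toAffine.Point := finite_point_baseChange_of_twist K V W h2 hC'
  obtain ⟨hshaK, hWR⟩ := hMilne V K h2 W ⟨C, hC'⟩ VK ⟨1, one_smul _ _⟩ hfinV hfinW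
  haveI : Finite VK.sha := hshaK
  haveI : Finite (AddCommGroup.primaryComponent VK.sha p) :=
    Finite.of_injective _ Subtype.val_injective
  have hSelfin : Finite (VK.selmerGroupPInfty p) :=
    (VK.finite_selmerGroupPInfty_iff p).mpr ⟨hEK, inferInstance⟩
  have hcard := card_identity_baseChange K V W h2 hC' hWR
  -- the cyclotomic setting over `K` (tree theorem), the Iwasawa module `X(V/K_∞)`
  obtain ⟨κ, hκ, γ, hγ, hγ'⟩ := exists_isCyclotomic_isTopGenerator_cyclotomicThree (K := K)
  obtain ⟨D⟩ := VK.nonempty_selmerDualData_holds κ γ hγ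
  haveI : Module.Finite (IwasawaAlgebra p) D.X :=
    (SelmerDualData.module_finite_of_isCyclotomic (W := VK) (κ := κ) hκ D) hγ
  -- the divisibility over `K`
  obtain ⟨hX, g, hgmem, u, hιg⟩ := hDivK κ γ hκ hγ hγ' D
  haveI : (Module.charIdeal (IwasawaAlgebra p) D.X).IsPrincipal := charIdeal_isPrincipal_holds p D.X
  obtain ⟨fE, hchar⟩ := Submodule.IsPrincipal.principal (Module.charIdeal (IwasawaAlgebra p) D.X)
  have hchar' : D.charIdeal = Ideal.span {fE} := hchar
  have hgmem' : g ∈ Ideal.span {fE} := by rw [← hchar']; exact hgmem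
  obtain ⟨h, hgh⟩ := Ideal.mem_span_singleton'.mp hgmem'
  -- Greenberg over `K`
  obtain ⟨u₁, hu₁⟩ := hGrK κ γ hκ hγ D hX fE hchar' hSelfin
  -- the analytic side over `ℚ` for `V`: `t_V = ϖ [0]⁺_f = L(V,1)/Ω_V`
  set sV : ℚ := ratPlusSymbol f 0 with hsV
  set tV : ℚ := ϖ * sV with htV
  have hΩV : (V.realPeriodRat : ℂ) ≠ 0 := by exact_mod_cast V.realPeriodRat_pos_holds.ne'
  have hLvalV : V.entireLFunction 1 = (((sV : ℝ) * plusPeriod f : ℝ) : ℂ) := hf.entireLFunction_one_eq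
  have hqV' : V.entireLFunction 1 / (V.realPeriodRat : ℂ) = ((tV : ℚ) : ℂ) := by
    rw [hLvalV, ← hϖ, div_eq_iff hΩV, htV]
    push_cast
    ring
  have htV0 : tV ≠ 0 := by
    intro h0
    apply hLV
    have := (div_eq_iff hΩV).mp hqV'
    rw [this, h0]
    simp
  obtain ⟨-, -, -, hshaV⟩ := Wuthrich2014.shaAn_eq_of_L_one_div_eq hGZK V hLV hqV'
  -- the analytic side over `ℚ` for `W`: odd Birch + Pal
  obtain ⟨ε, hε, hLW_eq⟩ :=
    entireLFunction_one_eq_of_twist_neg 3 hmod (by norm_num) V W C hC hadd hf ϖ' hϖ'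
  set S : ℚ := legendreMinusSymbolSum f 3 with hS
  set cinf : ℕ := (W.baseChange ℝ).numRealComponents with hcinf
  set tW : ℚ := ε * (ϖ' * S) / (|(C.u : ℚ)| * (cinf : ℚ)) with htW
  have hΩW : (W.realPeriodRat : ℂ) ≠ 0 := by exact_mod_cast W.realPeriodRat_pos_holds.ne'
  have hqW' : W.entireLFunction 1 / (W.realPeriodRat : ℂ) = (tW : ℂ) := by
    rw [hLW_eq, mul_div_cancel_right₀ _ hΩW]
  obtain ⟨-, -, -, hshaW⟩ := Wuthrich2014.shaAn_eq_of_L_one_div_eq hGZK W hLW hqW'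
  have hua0 : |(C.u : ℚ)| ≠ 0 := abs_ne_zero.mpr C.u.ne_zero
  have hcinf0 : (cinf : ℚ) ≠ 0 := by
    rw [hcinf, numRealComponents]
    split_ifs <;> norm_num
  have hden0 : |(C.u : ℚ)| * (cinf : ℚ) ≠ 0 := mul_ne_zero hua0 hcinf0
  have hϖS : ϖ' * S ≠ 0 := by
    intro h0
    apply hLW
    rw [hLW_eq, htW, h0, mul_zero, zero_div, Rat.cast_zero, zero_mul]
  have hε0 : ε ≠ 0 := by rcases hε with h | h <;> rw [h] <;> norm_num
  have htW0 : tW ≠ 0 := by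
    rw [htW]
    exact div_ne_zero (mul_ne_zero hε0 hϖS) hden0
  have hvε : padicValRat 3 ε = 0 := by
    rcases hε with h | h
    · rw [h, padicValRat.one]
    · rw [h, padicValRat.neg, padicValRat.one]
  have hvtW : padicValRat 3 tW = padicValRat 3 (ϖ' * S) - padicValRat 3 |(C.u : ℚ)| := by
    rw [htW, padicValRat.div (mul_ne_zero hε0 hϖS) hden0, padicValRat.mul hε0 hϖS,
      padicValRat.mul hua0 hcinf0, hvε, padicValRat_numRealComponents_eq_zero W 3 (by norm_num)]
    ring
  -- the constant term `g(0) = u·ϖϖ'·e⁺[0]⁺·e⁻S = (u e⁺ e⁻) · t_V · (ϖ'S)`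
  set E : ℚ_[3] := ((u : ℤ_[3]) : ℚ_[3]) * (((ep : ℤ_[3]) : ℚ_[3]) * ((em : ℤ_[3]) : ℚ_[3])) with hE
  have hg0 : ((PowerSeries.constantCoeff g : ℤ_[3]) : ℚ_[3]) =
      E * ((tV : ℚ) : ℚ_[3]) * ((ϖ' * S : ℚ) : ℚ_[3]) := by
    rw [← constantCoeff_iwasawaToPowerSeries 3 g, hιg]
    simp only [map_mul, PowerSeries.constantCoeff_C, hLp0, hLm0, htV, hE]
    push_cast
    ring
  -- `g(0) = h(0) · fE(0)`
  have hg0' : (PowerSeries.constantCoeff g : ℤ_[3]) =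
      PowerSeries.constantCoeff h * PowerSeries.constantCoeff fE := by
    rw [← hgh, map_mul]
  -- names
  set TK : ℚ_[3] := (Nat.card (AddCommGroup.primaryComponent VK.toAffine.Point 3) : ℚ_[3]) with hTK
  set ShK : ℚ_[3] := (Nat.card (AddCommGroup.primaryComponent VK.sha 3) : ℚ_[3]) with hShK
  set h0 : ℚ_[3] := ((PowerSeries.constantCoeff h : ℤ_[3]) : ℚ_[3]) with hh0
  set vK : ℕ := padicValNat 3 VK.tamagawaProduct with hvK
  have hSelK : (Nat.card (VK.selmerGroupPInfty 3) : ℚ_[3]) = ShK := by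
    rw [hShK, VK.natCard_selmerGroupPInfty_eq_natCard_primaryComponent_sha 3]
  have hTK0 : TK ≠ 0 := by rw [hTK]; exact_mod_cast Nat.card_pos.ne'
  have hShK0 : ShK ≠ 0 := by rw [hShK]; exact_mod_cast Nat.card_pos.ne'
  have hp0 : (3 : ℚ_[3]) ≠ 0 := by exact_mod_cast (by norm_num : (3 : ℕ) ≠ 0)
  have hh0val : 0 ≤ h0.valuation := by
    rw [hh0]
    exact PadicInt.valuation_coe_nonneg
  have htVQ : ((tV : ℚ) : ℚ_[3]) ≠ 0 := by exact_mod_cast htV0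
  have hϖSQ : ((ϖ' * S : ℚ) : ℚ_[3]) ≠ 0 := by exact_mod_cast hϖS
  have hE0 : E ≠ 0 :=
    mul_ne_zero (coe_units_ne_zero 3 u) (mul_ne_zero (coe_units_ne_zero 3 ep) (coe_units_ne_zero 3 em))
  have hg0ne : PowerSeries.constantCoeff g ≠ 0 := by
    intro h0'
    have h' : E * ((tV : ℚ) : ℚ_[3]) * ((ϖ' * S : ℚ) : ℚ_[3]) = 0 := by
      rw [← hg0, h0', PadicInt.coe_zero]
    exact mul_ne_zero (mul_ne_zero hE0 htVQ) hϖSQ h'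
  have hh0ne : h0 ≠ 0 := by
    rw [hh0]
    intro h0'
    apply hg0ne
    rw [hg0', (PadicInt.coe_eq_zero.mp h0'), zero_mul]
  -- KEY identity in `ℚ₃`: `(t_V · (ϖ'S) · T_K²) · E = h(0) · (u₁ · (3^{v_K} · #Ш(V_K)[3^∞]))`
  have key : (((tV : ℚ) : ℚ_[3]) * ((ϖ' * S : ℚ) : ℚ_[3]) * TK ^ 2) * E =
      h0 * (((u₁ : ℤ_[3]) : ℚ_[3]) * ((3 : ℚ_[3]) ^ vK * ShK)) := by
    have hg0Q : ((PowerSeries.constantCoeff g : ℤ_[3]) : ℚ_[3]) =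
        h0 * ((PowerSeries.constantCoeff fE : ℤ_[3]) : ℚ_[3]) := by
      rw [hg0', hh0]; push_cast; ring
    calc (((tV : ℚ) : ℚ_[3]) * ((ϖ' * S : ℚ) : ℚ_[3]) * TK ^ 2) * E
        = (E * ((tV : ℚ) : ℚ_[3]) * ((ϖ' * S : ℚ) : ℚ_[3])) * TK ^ 2 := by ring
      _ = (h0 * ((PowerSeries.constantCoeff fE : ℤ_[3]) : ℚ_[3])) * TK ^ 2 := by rw [← hg0, hg0Q]
      _ = h0 * (((PowerSeries.constantCoeff fE : ℤ_[3]) : ℚ_[3]) * TK ^ 2) := by ring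
      _ = h0 * (((u₁ : ℤ_[3]) : ℚ_[3]) * (3 : ℚ_[3]) ^ vK *
            (Nat.card (VK.selmerGroupPInfty 3) : ℚ_[3])) := by rw [hu₁]
      _ = h0 * (((u₁ : ℤ_[3]) : ℚ_[3]) * ((3 : ℚ_[3]) ^ vK * ShK)) := by rw [hSelK]; ring
  -- valuations of `key`
  have hvE : E.valuation = 0 := by
    rw [hE, Padic.valuation_mul (coe_units_ne_zero 3 u)
      (mul_ne_zero (coe_units_ne_zero 3 ep) (coe_units_ne_zero 3 em)),
      Padic.valuation_mul (coe_units_ne_zero 3 ep) (coe_units_ne_zero 3 em),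
      valuation_coe_units_eq_zero, valuation_coe_units_eq_zero, valuation_coe_units_eq_zero]
    ring
  have hu10 : ((u₁ : ℤ_[3]) : ℚ_[3]) ≠ 0 := coe_units_ne_zero 3 u₁
  have h3K : (3 : ℚ_[3]) ^ vK * ShK ≠ 0 := mul_ne_zero (pow_ne_zero _ hp0) hShK0
  have hval := congrArg Padic.valuation key
  rw [Padic.valuation_mul (mul_ne_zero (mul_ne_zero htVQ hϖSQ) (pow_ne_zero 2 hTK0)) hE0, hvE,
    Padic.valuation_mul (mul_ne_zero htVQ hϖSQ) (pow_ne_zero 2 hTK0), Padic.valuation_mul htVQ hϖSQ,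
    Padic.valuation_pow, Padic.valuation_ratCast, Padic.valuation_ratCast,
    Padic.valuation_mul hh0ne (mul_ne_zero hu10 h3K), Padic.valuation_mul hu10 h3K,
    valuation_coe_units_eq_zero, Padic.valuation_mul (pow_ne_zero _ hp0) hShK0, Padic.valuation_pow]
    at hval
  have hv3 : (3 : ℚ_[3]).valuation = 1 := by
    have h := Padic.valuation_p (p := 3)
    exact_mod_cast h
  rw [hv3] at hval
  -- `v(T_K) = ord₃ #V(K)`, `v(Ш_K[3^∞]) = ord₃ #Ш(V_K)`
  have hvTK : TK.valuation = (padicValNat 3 (Nat.card VK.toAffine.Point) : ℤ) := by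
    rw [hTK, Padic.valuation_natCast, padicValNat_card_addPrimaryComponent 3]
  have hvShK : ShK.valuation = (padicValNat 3 VK.shaOrder : ℤ) := by
    rw [hShK, Padic.valuation_natCast, padicValNat_card_addPrimaryComponent 3]
    rfl
  rw [hvTK, hvShK] at hval
  -- (I'): `v_K + ord₃ #Ш(V_K) ≤ ord₃ t_V + ord₃ (ϖ'S) + 2 ord₃ #V(K)`
  have hI : (vK : ℤ) + padicValNat 3 VK.shaOrder ≤
      padicValRat 3 tV + padicValRat 3 (ϖ' * S) + 2 * padicValNat 3 (Nat.card VK.toAffine.Point) := by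
    simp only [Nat.cast_ofNat] at hval
    linarith
  -- Milne's identity in valuations
  have hnV0 : ((V.baseChange ℝ).numRealComponents : ℚ) ≠ 0 := by
    rw [numRealComponents]; split_ifs <;> norm_num
  have hSV0 : (V.shaOrder : ℚ) ≠ 0 := by exact_mod_cast (V.shaOrder_pos hfinV).ne'
  have hSW0 : (W.shaOrder : ℚ) ≠ 0 := by exact_mod_cast (W.shaOrder_pos hfinW).ne'
  have hSK0 : (VK.shaOrder : ℚ) ≠ 0 := by exact_mod_cast (VK.shaOrder_pos hshaK).ne'
  have hcV0 : (V.tamagawaProduct : ℚ) ≠ 0 := by exact_mod_cast V.tamagawaProduct_pos_holds.ne'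
  have hcW0 : (W.tamagawaProduct : ℚ) ≠ 0 := by exact_mod_cast W.tamagawaProduct_pos_holds.ne'
  have hNV0 : ((Nat.card V.toAffine.Point : ℕ) : ℚ) ≠ 0 := by exact_mod_cast Nat.card_pos.ne'
  have hNW0 : ((Nat.card W.toAffine.Point : ℕ) : ℚ) ≠ 0 := by exact_mod_cast Nat.card_pos.ne'
  have hNK0 : ((Nat.card VK.toAffine.Point : ℕ) : ℚ) ≠ 0 := by exact_mod_cast Nat.card_pos.ne'
  have hRHS0 : ((V.baseChange ℝ).numRealComponents : ℚ) * |(C.u : ℚ)| * V.shaOrder * W.shaOrder *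
      V.tamagawaProduct * W.tamagawaProduct * ((Nat.card VK.toAffine.Point : ℕ) : ℚ) ^ 2 ≠ 0 :=
    mul_ne_zero (mul_ne_zero (mul_ne_zero (mul_ne_zero (mul_ne_zero (mul_ne_zero hnV0 hua0) hSV0)
      hSW0) hcV0) hcW0) (pow_ne_zero 2 hNK0)
  have hM0 : VK.modifiedTamagawaProduct ≠ 0 := by
    intro hM
    rw [hVK] at hM
    rw [hM, zero_mul, zero_mul, zero_mul] at hcard
    exact hRHS0 hcard.symm
  have hvM : padicValRat 3 VK.modifiedTamagawaProduct = padicValNat 3 VK.tamagawaProduct :=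
    padicValRat_modifiedTamagawaProduct_baseChange_of_mult V 3 hmult
  have hvcard := congrArg (padicValRat 3) hcard
  rw [hVK] at hM0
  rw [padicValRat.mul (mul_ne_zero (mul_ne_zero hM0 hSK0) (pow_ne_zero 2 hNV0)) (pow_ne_zero 2 hNW0),
    padicValRat.mul (mul_ne_zero hM0 hSK0) (pow_ne_zero 2 hNV0), padicValRat.mul hM0 hSK0,
    padicValRat.pow, padicValRat.pow,
    padicValRat.mul (mul_ne_zero (mul_ne_zero (mul_ne_zero (mul_ne_zero (mul_ne_zero hnV0 hua0) hSV0)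
      hSW0) hcV0) hcW0) (pow_ne_zero 2 hNK0),
    padicValRat.mul (mul_ne_zero (mul_ne_zero (mul_ne_zero (mul_ne_zero hnV0 hua0) hSV0) hSW0) hcV0) hcW0,
    padicValRat.mul (mul_ne_zero (mul_ne_zero (mul_ne_zero hnV0 hua0) hSV0) hSW0) hcV0,
    padicValRat.mul (mul_ne_zero (mul_ne_zero hnV0 hua0) hSV0) hSW0,
    padicValRat.mul (mul_ne_zero hnV0 hua0) hSV0, padicValRat.mul hnV0 hua0, padicValRat.pow,
    padicValRat_numRealComponents_eq_zero V 3 (by norm_num),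
    padicValRat.of_nat, padicValRat.of_nat, padicValRat.of_nat, padicValRat.of_nat,
    padicValRat.of_nat, padicValRat.of_nat, padicValRat.of_nat, padicValRat.of_nat] at hvcard
  rw [← hVK] at hvcard
  rw [hvM] at hvcard
  -- conclusion
  refine ⟨tV * (Nat.card V.toAffine.Point : ℚ) ^ 2 / (V.tamagawaProduct : ℚ),
    tW * (Nat.card W.toAffine.Point : ℚ) ^ 2 / (W.tamagawaProduct : ℚ), hshaV, hshaW, ?_⟩
  rw [padicValRat.div (mul_ne_zero htV0 (pow_ne_zero 2 hNV0)) hcV0,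
    padicValRat.mul htV0 (pow_ne_zero 2 hNV0), padicValRat.pow, padicValRat.of_nat, padicValRat.of_nat,
    padicValRat.div (mul_ne_zero htW0 (pow_ne_zero 2 hNW0)) hcW0,
    padicValRat.mul htW0 (pow_ne_zero 2 hNW0), padicValRat.pow, padicValRat.of_nat, padicValRat.of_nat,
    hvtW]
  push_cast at hI hvcard ⊢
  linarith

end Core

end Summit.BirchSwinnertonDyer.Rank1Residual.Additive

end
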